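import Literature.NumberTheory.Transcendental.KZCalculusProofs
import Literature.NumberTheory.Transcendental.KZLogCalculusProofs
import Literature.NumberTheory.Transcendental.KZDominatedFamilyRelations
import Literature.NumberTheory.Transcendental.KZBetaChains
import Literature.NumberTheory.Transcendental.KZCubeProducts
import Literature.NumberTheory.Transcendental.SemialgebraicRpow
import Literature.Analysis.SpecialFunctions.SelbergIntegralBasic

/-!
# `CompleteModGammaSector` (stmt-KontsevichZagierPeriods-14233), line `cusp-transport-to-the-beta-world`,
# LegendreSector chain (S2): stub `stub_integrateOutU` — integrating out the last coordinate of the cusp Beta cube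

Support file (`--supports stmt-KontsevichZagierPeriods-14233`) for the registered stub `stub_integrateOutU`
of the third engine client (`LegendreSector`, = `GaussManinCertificates.LegendreSector`,
stmt-KontsevichZagierPeriods-3013) of the line lead's skeleton.

Statement. For every integral representation `C` pinned to the cusp Beta cube
`[(0,1)², t^{-1/2}(1-t)^{-1/2}u^{-1/2}]` (`t = x 0`, `u = x 1` the LAST coordinate) there is a
representation `D` pinned to `[(0,1), 2 t^{-1/2}(1-t)^{-1/2}]` with `KZ.Equivalent C D`
(value identity `∫₀¹ u^{-1/2} du = 2`).

Proof (rules (1) and (3) of Kontsevich–Zagier 2001, §1.2, exactly as in the Literature template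
`KZ.betaTranslation_equivalent`). Let `B = [(0,1) × [0,1], t^{-1/2}(1-t)^{-1/2}u^{-1/2}]` be the
BAND representation over the base `(0,1)` with the constant bounds `a ≡ 0 ≤ b ≡ 1`. With the
primitive `H(t,u) = t^{-1/2}(1-t)^{-1/2} · 2u^{1/2}` — `ℚ`-semialgebraic on the band, continuous in
`u ∈ [0,1]`, with `∂_u H = t^{-1/2}(1-t)^{-1/2}u^{-1/2}` on `(0,1)` and
`H(t,1) − H(t,0) = 2 t^{-1/2}(1-t)^{-1/2}` — `[B] − [D]` is ONE Newton–Leibniz move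
(`KZ.newtonLeibnizRel`). The band differs from the open square `(0,1)²` by the two null faces
`u ∈ {0,1}`, so `[B] − [B|_{(0,1)²}] ∈ relations` (`KZ.IntegralRep.of_sub_of_restrict_mem_relations`),
and `[B|_{(0,1)²}] − [C] ∈ relations` by congruence of the integrands ON `(0,1)²`
(`KZ.of_sub_of_mem_relations_of_eqOn`). Everything is proved; no `def`, no named fact.

References: M. Kontsevich, D. Zagier, *Periods* (2001), §1.2, rules (1), (3);
G. E. Andrews, R. Askey, R. Roy, *Special Functions* (1999), §1.1.
-/

noncomputable section

-- `Summit.KontsevichZagierPeriods.KontsevichZagierPeriods.…` is the tree's mandated layout (single-conjunct summit).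
set_option linter.dupNamespace false

namespace Summit.KontsevichZagierPeriods.KontsevichZagierPeriods.CompleteModGammaSectorEngine

open MeasureTheory Set
open Literature.NumberTheory.Transcendental
open Literature.NumberTheory.Transcendental.KZ
open Literature.ModelTheory.ExponentialFields (IsSemialgebraic isSemialgebraic_setOf_eval_le)
open MvPolynomial (aeval X)

/-! ## Coordinates on `ℝ²` -/

/-- `(x, t)₀ = x₀` for `x ∈ ℝ¹`. [folklore] -/
private theorem snoc_apply_zero (x : Fin 1 → ℝ) (t : ℝ) : (Fin.snoc x t : Fin 2 → ℝ) 0 = x 0 := rfl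

/-- `(x, t)₁ = t` for `x ∈ ℝ¹`. [folklore] -/
private theorem snoc_apply_one (x : Fin 1 → ℝ) (t : ℝ) : (Fin.snoc x t : Fin 2 → ℝ) 1 = t := rfl

/-! ## The band `(0,1) × [0,1] ⊆ ℝ²` (Newton–Leibniz format over the base `(0,1) ⊆ ℝ¹`) -/

/-- Coordinates of a point of the band `(0,1) × [0,1]`. [folklore] -/
private theorem mem_unitBand {z : Fin 2 → ℝ}
    (hz : z ∈ {z : Fin 2 → ℝ | Fin.init z ∈ {x : Fin 1 → ℝ | x 0 ∈ Set.Ioo (0:ℝ) 1} ∧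
      (0:ℝ) ≤ z (Fin.last 1) ∧ z (Fin.last 1) ≤ 1}) :
    (0 < z 0 ∧ z 0 < 1) ∧ 0 ≤ z 1 ∧ z 1 ≤ 1 := hz

/-- The open unit square lies in the band `(0,1) × [0,1]`. [folklore] -/
private theorem cube_subset_unitBand :
    {x : Fin 2 → ℝ | ∀ i, x i ∈ Set.Ioo (0:ℝ) 1} ⊆
      {z : Fin 2 → ℝ | Fin.init z ∈ {x : Fin 1 → ℝ | x 0 ∈ Set.Ioo (0:ℝ) 1} ∧
        (0:ℝ) ≤ z (Fin.last 1) ∧ z (Fin.last 1) ≤ 1} :=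
  fun _ hz => ⟨hz 0, (hz 1).1.le, (hz 1).2.le⟩

/-- The band `(0,1) × [0,1] ⊆ ℝ²` is `ℚ`-semialgebraic (a cylinder cut by two polynomial
inequalities). [folklore] -/
private theorem isSemialgebraic_unitBand :
    IsSemialgebraic ℚ {z : Fin 2 → ℝ | Fin.init z ∈ {x : Fin 1 → ℝ | x 0 ∈ Set.Ioo (0:ℝ) 1} ∧
      (0:ℝ) ≤ z (Fin.last 1) ∧ z (Fin.last 1) ≤ 1} := by
  have h1 : IsSemialgebraic ℚ
      {z : Fin (1 + 1) → ℝ | Fin.init z ∈ {x : Fin 1 → ℝ | x 0 ∈ Set.Ioo (0:ℝ) 1}} :=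
    BallPeeling.isSemialgebraic_posIoo.setOf_init_mem
  have h2 := isSemialgebraic_setOf_eval_le (k := ℚ) (R := ℝ) (0 : MvPolynomial (Fin 2) ℚ)
    (X (Fin.last 1))
  have h3 := isSemialgebraic_setOf_eval_le (k := ℚ) (R := ℝ) (X (Fin.last 1) : MvPolynomial (Fin 2) ℚ) 1
  simp only [map_zero, map_one, MvPolynomial.aeval_X] at h2 h3
  convert (h1.inter h2).inter h3 using 1
  ext z
  simp only [mem_setOf_eq, mem_inter_iff, and_assoc]

/-- The band `(0,1) × [0,1]` differs from the open unit square by the two null faces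
`u ∈ {0, 1}`. [folklore] -/
private theorem volume_unitBand_diff_cube :
    volume ({z : Fin 2 → ℝ | Fin.init z ∈ {x : Fin 1 → ℝ | x 0 ∈ Set.Ioo (0:ℝ) 1} ∧
      (0:ℝ) ≤ z (Fin.last 1) ∧ z (Fin.last 1) ≤ 1} \ {x | ∀ i, x i ∈ Set.Ioo (0:ℝ) 1}) = 0 := by
  refine measure_mono_null (fun z hz => ?_)
    (measure_union_null (volume_setOf_last_eq_zero (n := 1) 0)
      (volume_setOf_last_eq_zero (n := 1) 1))
  obtain ⟨hz, hnot⟩ := hz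
  have hz' := mem_unitBand hz
  have hl : z (Fin.last 1) = z 1 := rfl
  simp only [mem_union, mem_setOf_eq, hl]
  by_contra h
  push Not at h
  apply hnot
  intro i
  fin_cases i
  · exact hz'.1
  · exact ⟨lt_of_le_of_ne hz'.2.1 (Ne.symm h.1), lt_of_le_of_ne hz'.2.2 h.2⟩

/-- A function integrable on the open unit square is integrable on the band `(0,1) × [0,1]`
(the difference is null). [folklore] -/
private theorem integrableOn_unitBand_of_cube {f : (Fin 2 → ℝ) → ℝ}
    (hf : IntegrableOn f {x : Fin 2 → ℝ | ∀ i, x i ∈ Set.Ioo (0:ℝ) 1}) :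
    IntegrableOn f {z : Fin 2 → ℝ | Fin.init z ∈ {x : Fin 1 → ℝ | x 0 ∈ Set.Ioo (0:ℝ) 1} ∧
      (0:ℝ) ≤ z (Fin.last 1) ∧ z (Fin.last 1) ≤ 1} := by
  have h := hf.union (IntegrableOn.of_measure_zero volume_unitBand_diff_cube)
  rwa [union_sdiff_cancel cube_subset_unitBand] at h

/-! ## Semialgebraic integrands (rational powers of polynomial factors) -/

/-- Rational powers (exponent `r = e ∈ ℚ`) of positive `ℚ`-semialgebraic functions
(`IsSemialgebraicFunOn.rpow_ratCast`). [cite: BochnakCosteRoy1998, Prop. 2.2.6] -/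
private theorem sa_rpow {s : Set (Fin 2 → ℝ)} (hs : IsSemialgebraic ℚ s) {g : (Fin 2 → ℝ) → ℝ}
    (hg : IsSemialgebraicFunOn ℚ s g) (hpos : ∀ z ∈ s, 0 < g z) (e : ℚ) {r : ℝ}
    (hr : (e : ℝ) = r) : IsSemialgebraicFunOn ℚ s (fun z => g z ^ r) := by
  subst hr
  exact hg.rpow_ratCast hs hpos e

/-- Rational powers with non-zero exponent `r = e ∈ ℚ` of non-negative `ℚ`-semialgebraic
functions (`IsSemialgebraicFunOn.rpow_ratCast_of_nonneg`). [cite: BochnakCosteRoy1998, Prop. 2.2.6] -/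
private theorem sa_rpow_nonneg {s : Set (Fin 2 → ℝ)} {g : (Fin 2 → ℝ) → ℝ}
    (hg : IsSemialgebraicFunOn ℚ s g) (hnn : ∀ z ∈ s, 0 ≤ g z) {e : ℚ} (he : e ≠ 0) {r : ℝ}
    (hr : (e : ℝ) = r) : IsSemialgebraicFunOn ℚ s (fun z => g z ^ r) := by
  subst hr
  exact hg.rpow_ratCast_of_nonneg hnn he

/-- Products of `ℚ`-semialgebraic functions (lambda form of `IsSemialgebraicFunOn.mul_holds`).
[cite: BochnakCosteRoy1998, Prop. 2.2.6] -/
private theorem sa_mul {s : Set (Fin 2 → ℝ)} {f g : (Fin 2 → ℝ) → ℝ}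
    (hf : IsSemialgebraicFunOn ℚ s f) (hg : IsSemialgebraicFunOn ℚ s g) :
    IsSemialgebraicFunOn ℚ s (fun z => f z * g z) :=
  (IsSemialgebraicFunOn.mul_holds hf hg).congr fun _ _ => rfl

/-- The common factor `t^{-1/2}(1-t)^{-1/2}` (`t = z 0`) is `ℚ`-semialgebraic on the band.
[cite: BochnakCosteRoy1998, Prop. 2.2.6] -/
private theorem sa_tFactor :
    IsSemialgebraicFunOn ℚ {z : Fin 2 → ℝ | Fin.init z ∈ {x : Fin 1 → ℝ | x 0 ∈ Set.Ioo (0:ℝ) 1} ∧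
      (0:ℝ) ≤ z (Fin.last 1) ∧ z (Fin.last 1) ≤ 1}
      (fun z : Fin 2 → ℝ => (z 0) ^ (-(1 / 2 : ℝ)) * (1 - z 0) ^ (-(1 / 2 : ℝ))) := by
  have hB := isSemialgebraic_unitBand
  refine sa_mul (sa_rpow hB ((isSemialgebraicFunOn_aeval hB (X 0)).congr fun z _ => by simp)
    (fun z hz => (mem_unitBand hz).1.1) (-1/2) (by norm_num))
    (sa_rpow hB ((isSemialgebraicFunOn_aeval hB (1 - X 0)).congr fun z _ => by simp)
    (fun z hz => by linarith [(mem_unitBand hz).1.2]) (-1/2) (by norm_num))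

/-- The cusp Beta integrand `t^{-1/2}(1-t)^{-1/2}u^{-1/2}` is `ℚ`-semialgebraic on the band
(on the face `u = 0` it takes Mathlib's value `0 ^ (-1/2) = 0`). [cite: BochnakCosteRoy1998, Prop. 2.2.6] -/
private theorem sa_integrand :
    IsSemialgebraicFunOn ℚ {z : Fin 2 → ℝ | Fin.init z ∈ {x : Fin 1 → ℝ | x 0 ∈ Set.Ioo (0:ℝ) 1} ∧
      (0:ℝ) ≤ z (Fin.last 1) ∧ z (Fin.last 1) ≤ 1}
      (fun x : Fin 2 → ℝ => (x 0) ^ (-(1 / 2 : ℝ)) * (1 - x 0) ^ (-(1 / 2 : ℝ)) *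
        (x 1) ^ (-(1 / 2 : ℝ))) := by
  have hB := isSemialgebraic_unitBand
  exact sa_mul sa_tFactor
    (sa_rpow_nonneg ((isSemialgebraicFunOn_aeval hB (X 1)).congr fun z _ => by simp)
      (fun z hz => (mem_unitBand hz).2.1) (e := -1/2) (by norm_num) (by norm_num))

/-- The primitive `H = t^{-1/2}(1-t)^{-1/2} · 2u^{1/2}` is `ℚ`-semialgebraic on the band.
[cite: BochnakCosteRoy1998, Prop. 2.2.6] -/
private theorem sa_primitive :
    IsSemialgebraicFunOn ℚ {z : Fin 2 → ℝ | Fin.init z ∈ {x : Fin 1 → ℝ | x 0 ∈ Set.Ioo (0:ℝ) 1} ∧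
      (0:ℝ) ≤ z (Fin.last 1) ∧ z (Fin.last 1) ≤ 1}
      (fun z : Fin 2 → ℝ => (z 0) ^ (-(1 / 2 : ℝ)) * (1 - z 0) ^ (-(1 / 2 : ℝ)) *
        (2 * (z 1) ^ (1 / 2 : ℝ))) := by
  have hB := isSemialgebraic_unitBand
  exact sa_mul sa_tFactor
    (sa_mul ((isSemialgebraicFunOn_natCast hB 2).congr fun z _ => by simp)
      (sa_rpow_nonneg ((isSemialgebraicFunOn_aeval hB (X 1)).congr fun z _ => by simp)
        (fun z hz => (mem_unitBand hz).2.1) (e := 1/2) (by norm_num) (by norm_num)))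

/-! ## The target representation `[(0,1), 2 t^{-1/2}(1-t)^{-1/2}]` -/

/-- `2 t^{-1/2}(1-t)^{-1/2}` is `ℚ`-semialgebraic on `(0,1) ⊆ ℝ¹`
(`KZ.isSemialgebraicFunOn_const_mul_rpow_mul_rpow`). [cite: BochnakCosteRoy1998, Prop. 2.2.6] -/
private theorem sa_target :
    IsSemialgebraicFunOn ℚ {x : Fin 1 → ℝ | x 0 ∈ Set.Ioo (0:ℝ) 1}
      (fun x : Fin 1 → ℝ => 2 * ((x 0) ^ (-(1 / 2 : ℝ)) * (1 - x 0) ^ (-(1 / 2 : ℝ)))) := by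
  refine (isSemialgebraicFunOn_const_mul_rpow_mul_rpow 2 (-1/2) (-1/2)).congr fun x _ => ?_
  have he : ((-1/2 : ℚ) : ℝ) = -(1 / 2 : ℝ) := by norm_num
  simp only [he, Rat.cast_ofNat]

/-- `2 t^{-1/2}(1-t)^{-1/2}` is integrable on `(0,1) ⊆ ℝ¹` (Euler's Beta integral `B(½,½)`).
[cite: AndrewsAskeyRoy1999, §1.1] -/
private theorem integrableOn_target :
    IntegrableOn (fun x : Fin 1 → ℝ => 2 * ((x 0) ^ (-(1 / 2 : ℝ)) * (1 - x 0) ^ (-(1 / 2 : ℝ))))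
      {x : Fin 1 → ℝ | x 0 ∈ Set.Ioo (0:ℝ) 1} := by
  have h := (Literature.Analysis.SpecialFunctions.Selberg.integrableOn_Ioo_rpow_mul_one_sub_rpow_and_integral_eq
    (a := 1 / 2) (b := 1 / 2) (by norm_num) (by norm_num)).1
  have h12 : (1 / 2 : ℝ) - 1 = -(1 / 2 : ℝ) := by norm_num
  rw [h12] at h
  exact (integrableOn_setOf_apply_mem_iff.2 h).const_mul 2

/-! ## The registered stub -/

/-- **Registered stub `stub_integrateOutU`** (LegendreSector chain, link S2): integrate out the
last coordinate `u` of the cusp Beta cube — for every `C` pinned to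
`[(0,1)², t^{−1/2}(1−t)^{−1/2}u^{−1/2}]` there is `D` pinned to `[(0,1), 2t^{−1/2}(1−t)^{−1/2}]`
with `Equivalent C D`. ONE Newton–Leibniz move over the base `(0,1)` (band `(0,1) × [0,1]`,
bounds `a ≡ 0`, `b ≡ 1`, primitive `H = t^{−1/2}(1−t)^{−1/2}·2u^{1/2}`, continuous on `[0,1]`,
`∂_u H =` the integrand on `(0,1)`, `H(t,1) − H(t,0) = 2t^{−1/2}(1−t)^{−1/2}`), the two null
faces `u ∈ {0,1}` dropped by domain additivity, and congruence of integrands on `(0,1)²`.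
Value identity: `∫₀¹ u^{−1/2} du = 2`. [cite: KontsevichZagier2001, §1.2 rule (3)] -/
theorem stub_integrateOutU :
    ∀ (C : IntegralRep 2), C.domain = {x | ∀ i, x i ∈ Set.Ioo (0 : ℝ) 1} → Set.EqOn C.integrand (fun x : Fin 2 → ℝ => (x 0) ^ (-(1 / 2 : ℝ)) * (1 - x 0) ^ (-(1 / 2 : ℝ)) * (x 1) ^ (-(1 / 2 : ℝ))) C.domain → ∃ D : IntegralRep 1, D.domain = {x | x 0 ∈ Set.Ioo (0 : ℝ) 1} ∧ Set.EqOn D.integrand (fun x : Fin 1 → ℝ => 2 * ((x 0) ^ (-(1 / 2 : ℝ)) * (1 - x 0) ^ (-(1 / 2 : ℝ)))) D.domain ∧ Equivalent C D := by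
  intro C hCd hCi
  -- (a) the target representation `D = [(0,1), 2 t^{-1/2}(1-t)^{-1/2}]`
  obtain ⟨D, hDd, hDi⟩ : ∃ D : IntegralRep 1, D.domain = {x | x 0 ∈ Set.Ioo (0 : ℝ) 1} ∧
      D.integrand = fun x : Fin 1 → ℝ => 2 * ((x 0) ^ (-(1 / 2 : ℝ)) * (1 - x 0) ^ (-(1 / 2 : ℝ))) :=
    ⟨⟨_, _, BallPeeling.isSemialgebraic_posIoo, sa_target, integrableOn_target⟩, rfl, rfl⟩
  -- (b) the band representation `B = [(0,1) × [0,1], t^{-1/2}(1-t)^{-1/2}u^{-1/2}]`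
  --     (integrable: on the open square it is `C.integrand`, and the two extra faces are null)
  have hIcube : IntegrableOn (fun x : Fin 2 → ℝ => (x 0) ^ (-(1 / 2 : ℝ)) * (1 - x 0) ^ (-(1 / 2 : ℝ)) *
      (x 1) ^ (-(1 / 2 : ℝ))) {x : Fin 2 → ℝ | ∀ i, x i ∈ Set.Ioo (0:ℝ) 1} := by
    have h := C.integrableOn.congr_fun hCi (IntegralRep.measurableSet_domain_holds C)
    rwa [hCd] at h
  obtain ⟨B, hBd, hBi⟩ : ∃ B : IntegralRep 2,
      B.domain = {z : Fin 2 → ℝ | Fin.init z ∈ {x : Fin 1 → ℝ | x 0 ∈ Set.Ioo (0:ℝ) 1} ∧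
        (0:ℝ) ≤ z (Fin.last 1) ∧ z (Fin.last 1) ≤ 1} ∧
      B.integrand = fun x : Fin 2 → ℝ => (x 0) ^ (-(1 / 2 : ℝ)) * (1 - x 0) ^ (-(1 / 2 : ℝ)) *
        (x 1) ^ (-(1 / 2 : ℝ)) :=
    ⟨⟨_, _, isSemialgebraic_unitBand, sa_integrand, integrableOn_unitBand_of_cube hIcube⟩, rfl, rfl⟩
  -- (c) ONE Newton–Leibniz move along `u`: `[B] − [D] ∈ newtonLeibnizRel`
  have hNL : of B - of D ∈ newtonLeibnizRel := by
    refine ⟨1, B, D, fun _ => (0:ℝ), fun _ => (1:ℝ),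
      fun z : Fin 2 → ℝ => (z 0) ^ (-(1 / 2 : ℝ)) * (1 - z 0) ^ (-(1 / 2 : ℝ)) * (2 * (z 1) ^ (1 / 2 : ℝ)),
      ?_, ?_, ?_, fun _ _ => zero_le_one, ?_, ?_, ?_, ?_, rfl⟩
    · rw [hBd]
      exact sa_primitive
    · rw [hDd]
      exact (isSemialgebraicFunOn_natCast BallPeeling.isSemialgebraic_posIoo 0).congr fun _ _ => by simp
    · rw [hDd]
      exact (isSemialgebraicFunOn_natCast BallPeeling.isSemialgebraic_posIoo 1).congr fun _ _ => by simp
    · rw [hBd, hDd]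
    · intro x _
      simp only [snoc_apply_zero, snoc_apply_one]
      exact continuousOn_const.mul (continuousOn_const.mul
        (continuousOn_id.rpow_const fun t _ => Or.inr (by norm_num)))
    · intro x _ t ht
      have ht' : t ∈ Set.Ioo (0:ℝ) 1 := ht
      simp only [hBi, snoc_apply_zero, snoc_apply_one]
      have h := ((Real.hasDerivAt_rpow_const (p := (1 / 2 : ℝ)) (Or.inl ht'.1.ne')).const_mul
        (2:ℝ)).const_mul ((x 0) ^ (-(1 / 2 : ℝ)) * (1 - x 0) ^ (-(1 / 2 : ℝ)))
      refine h.congr_deriv ?_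
      rw [show (1 / 2 : ℝ) - 1 = -(1 / 2 : ℝ) by norm_num]
      ring
    · intro x _
      simp only [hDi, snoc_apply_zero, snoc_apply_one, Real.one_rpow,
        Real.zero_rpow (by norm_num : (1 / 2 : ℝ) ≠ 0), mul_zero, sub_zero]
      ring
  -- (d) drop the null faces `u ∈ {0, 1}` (domain additivity) and pin `C` (congruence on `(0,1)²`)
  have hsub : C.domain ⊆ B.domain := by
    rw [hCd, hBd]
    exact cube_subset_unitBand
  have h1 : of B - of D ∈ relations := newtonLeibnizRel_subset_relations hNL
  have h2 : of B - of (B.restrict C.domain C.isSemialgebraic_domain hsub) ∈ relations :=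
    B.of_sub_of_restrict_mem_relations C.isSemialgebraic_domain hsub (by
      rw [hBd, hCd]
      exact volume_unitBand_diff_cube)
  have h3 : of (B.restrict C.domain C.isSemialgebraic_domain hsub) - of C ∈ relations :=
    of_sub_of_mem_relations_of_eqOn rfl fun x hx => by
      rw [IntegralRep.integrand_restrict, hBi]
      exact (hCi hx).symm
  refine ⟨D, hDd, fun x _ => by rw [hDi], ?_⟩
  have hsum : of C - of D = (of B - of D) - (of B - of (B.restrict C.domain C.isSemialgebraic_domain hsub)) -
      (of (B.restrict C.domain C.isSemialgebraic_domain hsub) - of C) := by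
    abel
  show of C - of D ∈ relations
  rw [hsum]
  exact relations.sub_mem (relations.sub_mem h1 h2) h3

end Summit.KontsevichZagierPeriods.KontsevichZagierPeriods.CompleteModGammaSectorEngine
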